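import Mathlib
import Literature.AlgebraicGeometry.Resolution.AugmentationIdeal
import Literature.AlgebraicGeometry.Resolution.FiniteQuotientSingularityPresentation
import Summits.ResolutionOfSingularities.ResolutionOfSingularities.Theorems.WildQuotientsWildQuotientResolutionInvolutionOnInvariants
import Summits.ResolutionOfSingularities.ResolutionOfSingularities.Theorems.WildQuotientsWildQuotientResolutionInvolutionKLTwice
import Summits.ResolutionOfSingularities.ResolutionOfSingularities.Theorems.WildQuotientsWildQuotientResolutionInvolutionFixedLocusRadical
import Summits.ResolutionOfSingularities.ResolutionOfSingularities.Theorems.WildQuotientsWildQuotientResolutionJordanFiveMu2CoverLaws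
import Summits.ResolutionOfSingularities.ResolutionOfSingularities.Theorems.WildQuotientsWildQuotientResolutionJordanFiveMu2CoverDescent
import Summits.ResolutionOfSingularities.ResolutionOfSingularities.Theorems.WildQuotientsWildQuotientResolutionJordanFiveMu2CoverAction
import Summits.ResolutionOfSingularities.ResolutionOfSingularities.Theorems.WildQuotientsWildQuotientResolutionJordanFiveMu2CoverActionExists
import Summits.ResolutionOfSingularities.ResolutionOfSingularities.Theorems.WildQuotientsWildQuotientResolutionJordanFiveMu2CoverKL

/-!
# RUNG V5 (`J₅`), brick B7/HP₂ — part (γ): the fixed locus of `τ̄` on `U₂/σ` is the image of `{s = Y₁ = Y₃ = 0}`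

Sub-problem `ResolutionOfSingularities`, crux `WildQuotients.WildQuotientResolution`
(stmt-ResolutionOfSingularities-15640), line L1 W4.5c, brick `HP₂` (res-L1-w45c-plan-1 RULINGs
10:50Z / 14:04:47Z; card `mu2-strata-kl-twice`). [OURS · L1 W4.5c]

For a localisation `U` of `k[s, Y, pass] ⧸ I` away from `ι` (a domain), a `k`-automorphism `σ_U`
with the cover laws (`ι` fixed) and a `k`-automorphism `τ_U` with the deck laws (`ι` fixed),
`p ≥ 5 = char k`:

* `cover_comm_coverTau_apply` — `σ_U τ_U = τ_U σ_U` on `U`; `cover_pow_prime_eq_one_U` — `σ_U^p = 1`;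
* `augIdeal_cover_le_span_s` — `I_{σ_U} ⊆ (s)`; `augIdeal_coverTau_le_oddIdeal` —
  `I_{τ_U} ⊆ (s, Y₁, Y₃)`;
* **`cover_comap_radical_oddIdeal_eq_augIdeal`** — for the restriction `τ̄` of `τ_U` to the (regular)
  ring of invariants `V = U^{⟨σ_U⟩}`: `√(s, Y₁, Y₃) ∩ V = I_{τ̄}` (the norms `N(Y₁), N(Y₃)` and `s` are
  `τ̄`-anti-invariant elements of `V` with `N(Y) ≡ Y^p (mod s)`; bridge
  `InvolutionExit.comap_radical_eq_augIdeal`, p536388).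
-/

-- single-problem summit: the doubled namespace component `ResolutionOfSingularities` is forced
set_option linter.dupNamespace false

noncomputable section

open MvPolynomial Literature.AlgebraicGeometry.Resolution
open Summit.ResolutionOfSingularities.ResolutionOfSingularities.Theorems.WildQuotientResolution.TameTransfer
  (mem_fixedPoints_zpowers_iff_apply_eq)

namespace Summit.ResolutionOfSingularities.ResolutionOfSingularities.Theorems.WildQuotientResolution.JordanFive

variable (k : Type) [Field k] (n : ℕ) (a b c d e : Fin n)
  (hab : a ≠ b) (hac : a ≠ c) (had : a ≠ d) (hae : a ≠ e) (hbc : b ≠ c) (hbd : b ≠ d)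
  (hbe : b ≠ e) (hcd : c ≠ d) (hce : c ≠ e) (hde : d ≠ e)
  (I : Ideal (MvPolynomial (Option (Fin n)) k)) (ι : MvPolynomial (Option (Fin n)) k)
  (U : Type) [CommRing U] [Algebra (MvPolynomial (Option (Fin n)) k ⧸ I) U]
  [IsLocalization.Away (Ideal.Quotient.mk I ι) U] [Algebra k U]
  [IsScalarTower k (MvPolynomial (Option (Fin n)) k ⧸ I) U]
  (σU : U ≃ₐ[k] U)
  (hs : σU (algebraMap _ U (Ideal.Quotient.mk I (X none))) =
    algebraMap _ U (Ideal.Quotient.mk I (X none)))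
  (h1 : σU (algebraMap _ U (Ideal.Quotient.mk I (X (some b)))) =
    algebraMap _ U (Ideal.Quotient.mk I (X (some b))) +
      algebraMap _ U (Ideal.Quotient.mk I (X none)) *
        algebraMap _ U (Ideal.Quotient.mk I (X (some a))))
  (h2 : σU (algebraMap _ U (Ideal.Quotient.mk I (X (some c)))) =
    algebraMap _ U (Ideal.Quotient.mk I (X (some c))) +
      algebraMap _ U (Ideal.Quotient.mk I (X none)) *
        algebraMap _ U (Ideal.Quotient.mk I (X (some b))))
  (h3 : σU (algebraMap _ U (Ideal.Quotient.mk I (X (some d)))) =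
    algebraMap _ U (Ideal.Quotient.mk I (X (some d))) +
      algebraMap _ U (Ideal.Quotient.mk I (X none)) *
        algebraMap _ U (Ideal.Quotient.mk I (X (some c))))
  (h4 : σU (algebraMap _ U (Ideal.Quotient.mk I (X (some e)))) =
    algebraMap _ U (Ideal.Quotient.mk I (X (some e))) +
      algebraMap _ U (Ideal.Quotient.mk I (X none)) *
        algebraMap _ U (Ideal.Quotient.mk I (X (some d))))
  (hσ : ∀ i, i ≠ b → i ≠ c → i ≠ d → i ≠ e →
    σU (algebraMap _ U (Ideal.Quotient.mk I (X (some i)))) =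
      algebraMap _ U (Ideal.Quotient.mk I (X (some i))))
  (hσι : σU (algebraMap _ U (Ideal.Quotient.mk I ι)) = algebraMap _ U (Ideal.Quotient.mk I ι))
  (τU : U ≃ₐ[k] U)
  (τs : τU (algebraMap _ U (Ideal.Quotient.mk I (X none))) =
    -algebraMap _ U (Ideal.Quotient.mk I (X none)))
  (τb : τU (algebraMap _ U (Ideal.Quotient.mk I (X (some b)))) =
    -algebraMap _ U (Ideal.Quotient.mk I (X (some b))))
  (τd : τU (algebraMap _ U (Ideal.Quotient.mk I (X (some d)))) =
    -algebraMap _ U (Ideal.Quotient.mk I (X (some d))))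
  (τi : ∀ i, i ≠ b → i ≠ d → τU (algebraMap _ U (Ideal.Quotient.mk I (X (some i)))) =
    algebraMap _ U (Ideal.Quotient.mk I (X (some i))))
  (hτι : τU (algebraMap _ U (Ideal.Quotient.mk I ι)) = algebraMap _ U (Ideal.Quotient.mk I ι))

/-! ## Invariance of `1/ι`, commutation, order -/

omit [IsScalarTower k (MvPolynomial (Option (Fin n)) k ⧸ I) U] in
/-- An automorphism fixing `π ι` fixes `1/ι`. [folklore] -/
theorem apply_invSelf_of_apply_eq (φ : U ≃ₐ[k] U)
    (hφ : φ (algebraMap _ U (Ideal.Quotient.mk I ι)) = algebraMap _ U (Ideal.Quotient.mk I ι)) :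
    φ (IsLocalization.Away.invSelf (Ideal.Quotient.mk I ι)) =
      IsLocalization.Away.invSelf (Ideal.Quotient.mk I ι) := by
  have e1 : algebraMap _ U (Ideal.Quotient.mk I ι) *
      IsLocalization.Away.invSelf (Ideal.Quotient.mk I ι) = 1 := IsLocalization.Away.mul_invSelf _
  have e2 : algebraMap _ U (Ideal.Quotient.mk I ι) *
      φ (IsLocalization.Away.invSelf (Ideal.Quotient.mk I ι)) = 1 := by
    rw [← hφ, ← map_mul, e1, map_one]
  calc φ (IsLocalization.Away.invSelf (Ideal.Quotient.mk I ι))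
      = φ (IsLocalization.Away.invSelf (Ideal.Quotient.mk I ι)) *
          (algebraMap _ U (Ideal.Quotient.mk I ι) *
            IsLocalization.Away.invSelf (Ideal.Quotient.mk I ι)) := by rw [e1, mul_one]
    _ = algebraMap _ U (Ideal.Quotient.mk I ι) *
          φ (IsLocalization.Away.invSelf (Ideal.Quotient.mk I ι)) *
            IsLocalization.Away.invSelf (Ideal.Quotient.mk I ι) := by ring
    _ = IsLocalization.Away.invSelf (Ideal.Quotient.mk I ι) := by rw [e2, one_mul]

include ι hab hac had hae hbc hbe hcd hde hs h1 h2 h3 h4 hσ τs τb τd τi in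
/-- **`σ_U τ_U = τ_U σ_U`** (checked on the variables). [OURS · L1 W4.5c] -/
theorem cover_comm_coverTau_apply (u : U) : σU (τU u) = τU (σU u) := by
  have key : ((τU.trans σU : U ≃ₐ[k] U) : U →ₐ[k] U) = ((σU.trans τU : U ≃ₐ[k] U) : U →ₐ[k] U) := by
    refine away_quotient_algHom_ext k n I ι U (fun o => ?_)
    change σU (τU (algebraMap _ U (Ideal.Quotient.mk I (X o)))) =
      τU (σU (algebraMap _ U (Ideal.Quotient.mk I (X o))))
    rcases o with _ | i
    · rw [τs, map_neg, hs, τs]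
    · by_cases hia : i = a
      · subst hia; rw [τi i hab had, hσ i hab hac had hae, τi i hab had]
      by_cases hib : i = b
      · subst hib; rw [τb, map_neg, h1, map_add, map_mul, τb, τs, τi a hab had]; ring
      by_cases hic : i = c
      · subst hic; rw [τi i (Ne.symm hbc) hcd, h2, map_add, map_mul, τi i (Ne.symm hbc) hcd, τs, τb]
        ring
      by_cases hid : i = d
      · subst hid; rw [τd, map_neg, h3, map_add, map_mul, τd, τs, τi c (Ne.symm hbc) hcd]; ring
      by_cases hie : i = e
      · subst hie
        rw [τi i (Ne.symm hbe) (Ne.symm hde), h4, map_add, map_mul, τi i (Ne.symm hbe) (Ne.symm hde),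
          τs, τd]
        ring
      rw [τi i hib hid, hσ i hib hic hid hie, τi i hib hid]
  have := DFunLike.congr_fun key u
  exact this

include ι hab hac had hae hbc hbd hbe hcd hce hde hs h1 h2 h3 h4 hσ in
/-- **`σ_U ^ p = 1`** in characteristic `p ≥ 5`. [OURS · L1 W4.5c] -/
theorem cover_pow_prime_eq_one_U {p : ℕ} [CharP k p] (hp : p.Prime) (hp5 : 5 ≤ p) :
    σU ^ p = 1 := by
  obtain ⟨σA, hAs, hA1, hA2, hA3, hA4, hAσ⟩ :=
    exists_coverSigma k n a b c d e hab hac had hae hbc hbd hbe hcd hce hde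
  exact cover_pow_eq_one_of k n I ι U σU σA
    (cover_laws_comp k n a b c d e I U σU σA hs h1 h2 h3 h4 hσ hAs hA1 hA2 hA3 hA4 hAσ) p
    (cover_pow_prime_eq_one k n σA a b c d e hab hac had hae hAs hA1 hA2 hA3 hA4 hAσ p hp hp5)

include ι τs τb τd τi in
/-- **`τ_U ∘ τ_U = id`** (checked on the variables). [OURS · L1 W4.5c] -/
theorem coverTau_involutive (u : U) : τU (τU u) = u := by
  have key : ((τU.trans τU : U ≃ₐ[k] U) : U →ₐ[k] U) = AlgHom.id k U := by
    refine away_quotient_algHom_ext k n I ι U (fun o => ?_)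
    change τU (τU (algebraMap _ U (Ideal.Quotient.mk I (X o)))) =
      algebraMap _ U (Ideal.Quotient.mk I (X o))
    rcases o with _ | i
    · rw [τs, map_neg, τs, neg_neg]
    · by_cases hib : i = b
      · subst hib; rw [τb, map_neg, τb, neg_neg]
      by_cases hid : i = d
      · subst hid; rw [τd, map_neg, τd, neg_neg]
      rw [τi i hib hid, τi i hib hid]
  exact DFunLike.congr_fun key u

/-! ## The two augmentation ideals on `U` -/

include hab hac had hae hs h1 h2 h3 h4 hσ hσι in
/-- **`I_{σ_U} ⊆ (s)`.** [OURS · L1 W4.5c] -/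
theorem augIdeal_cover_le_span_s :
    augIdeal σU ≤ Ideal.span {algebraMap _ U (Ideal.Quotient.mk I (X none))} := by
  rw [augIdeal_def]
  refine Ideal.span_le.2 ?_
  rintro _ ⟨u, rfl⟩
  have hu : u ∈ Algebra.adjoin k (Set.range (fun o => algebraMap _ U (Ideal.Quotient.mk I (X o))) ∪
      {IsLocalization.Away.invSelf (Ideal.Quotient.mk I ι)}) := by
    rw [away_quotient_adjoin_eq_top k n I ι U]; exact Algebra.mem_top
  refine sub_mem_of_mem_adjoin (σU : U →ₐ[k] U) _ _ (fun g hg => ?_) hu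
  change σU g - g ∈ _
  rcases hg with ⟨o, rfl⟩ | hg
  · rcases o with _ | i
    · rw [hs, sub_self]; exact zero_mem _
    · by_cases hib : i = b
      · subst hib; rw [h1, add_sub_cancel_left]
        exact Ideal.mul_mem_right _ _ (Ideal.mem_span_singleton_self _)
      by_cases hic : i = c
      · subst hic; rw [h2, add_sub_cancel_left]
        exact Ideal.mul_mem_right _ _ (Ideal.mem_span_singleton_self _)
      by_cases hid : i = d
      · subst hid; rw [h3, add_sub_cancel_left]
        exact Ideal.mul_mem_right _ _ (Ideal.mem_span_singleton_self _)
      by_cases hie : i = e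
      · subst hie; rw [h4, add_sub_cancel_left]
        exact Ideal.mul_mem_right _ _ (Ideal.mem_span_singleton_self _)
      rw [hσ i hib hic hid hie, sub_self]; exact zero_mem _
  · rw [Set.mem_singleton_iff] at hg
    rw [hg, apply_invSelf_of_apply_eq k n I ι U σU hσι, sub_self]
    exact zero_mem _

include τs τb τd τi hτι in
/-- **`I_{τ_U} ⊆ (s, Y₁, Y₃)`.** [OURS · L1 W4.5c] -/
theorem augIdeal_coverTau_le_oddIdeal :
    augIdeal τU ≤ Ideal.span {algebraMap _ U (Ideal.Quotient.mk I (X none)),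
      algebraMap _ U (Ideal.Quotient.mk I (X (some b))),
      algebraMap _ U (Ideal.Quotient.mk I (X (some d)))} := by
  rw [augIdeal_def]
  refine Ideal.span_le.2 ?_
  rintro _ ⟨u, rfl⟩
  have hu : u ∈ Algebra.adjoin k (Set.range (fun o => algebraMap _ U (Ideal.Quotient.mk I (X o))) ∪
      {IsLocalization.Away.invSelf (Ideal.Quotient.mk I ι)}) := by
    rw [away_quotient_adjoin_eq_top k n I ι U]; exact Algebra.mem_top
  have hsm : algebraMap _ U (Ideal.Quotient.mk I (X none)) ∈ Ideal.span
      {algebraMap _ U (Ideal.Quotient.mk I (X none)), algebraMap _ U (Ideal.Quotient.mk I (X (some b))),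
        algebraMap _ U (Ideal.Quotient.mk I (X (some d)))} := Ideal.subset_span (Set.mem_insert _ _)
  have hbm : algebraMap _ U (Ideal.Quotient.mk I (X (some b))) ∈ Ideal.span
      {algebraMap _ U (Ideal.Quotient.mk I (X none)), algebraMap _ U (Ideal.Quotient.mk I (X (some b))),
        algebraMap _ U (Ideal.Quotient.mk I (X (some d)))} :=
    Ideal.subset_span (Set.mem_insert_of_mem _ (Set.mem_insert _ _))
  have hdm : algebraMap _ U (Ideal.Quotient.mk I (X (some d))) ∈ Ideal.span
      {algebraMap _ U (Ideal.Quotient.mk I (X none)), algebraMap _ U (Ideal.Quotient.mk I (X (some b))),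
        algebraMap _ U (Ideal.Quotient.mk I (X (some d)))} :=
    Ideal.subset_span (Set.mem_insert_of_mem _ (Set.mem_insert_of_mem _ rfl))
  refine sub_mem_of_mem_adjoin (τU : U →ₐ[k] U) _ _ (fun g hg => ?_) hu
  change τU g - g ∈ _
  rcases hg with ⟨o, rfl⟩ | hg
  · rcases o with _ | i
    · rw [τs, show ∀ x : U, -x - x = (-2) * x from fun x => by ring]
      exact Ideal.mul_mem_left _ _ hsm
    · by_cases hib : i = b
      · subst hib; rw [τb, show ∀ x : U, -x - x = (-2) * x from fun x => by ring]
        exact Ideal.mul_mem_left _ _ hbm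
      by_cases hid : i = d
      · subst hid; rw [τd, show ∀ x : U, -x - x = (-2) * x from fun x => by ring]
        exact Ideal.mul_mem_left _ _ hdm
      rw [τi i hib hid, sub_self]; exact zero_mem _
  · rw [Set.mem_singleton_iff] at hg
    rw [hg, apply_invSelf_of_apply_eq k n I ι U τU hτι, sub_self]
    exact zero_mem _

/-! ## The bridge on the cover -/

include hab hac had hae hbc hbd hbe hcd hce hde hs h1 h2 h3 h4 hσ hσι τs τb τd τi hτι in
/-- **(γ) The fixed locus of `τ̄` on `Spec U^{⟨σ_U⟩}` is the image of `{s = Y₁ = Y₃ = 0}`:**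
`√(s, Y₁, Y₃) ∩ V = I_{τ̄}` for `V = U^{⟨σ_U⟩}` (regular) and the restriction `τ̄` of `τ_U` to `V`
(`p ≥ 5`, `U` a domain).  The elements `s, N(Y₁), N(Y₃) ∈ V` (`N` = orbit product under `σ_U`) are
`τ̄`-anti-invariant, hence in `I_{τ̄}`, and `N(Y) ≡ Y^p (mod s)`. [OURS · L1 W4.5c] -/
theorem cover_comap_radical_oddIdeal_eq_augIdeal {p : ℕ} [CharP k p] (hp : p.Prime) (hp5 : 5 ≤ p)
    [IsDomain U] [IsRegularRing (FixedPoints.subalgebra k U (Subgroup.zpowers σU))]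
    (τbar : FixedPoints.subalgebra k U (Subgroup.zpowers σU) ≃ₐ[k]
      FixedPoints.subalgebra k U (Subgroup.zpowers σU))
    (hτbar : ∀ v, ((τbar v : FixedPoints.subalgebra k U (Subgroup.zpowers σU)) : U) = τU v) :
    (Ideal.span {algebraMap _ U (Ideal.Quotient.mk I (X none)),
        algebraMap _ U (Ideal.Quotient.mk I (X (some b))),
        algebraMap _ U (Ideal.Quotient.mk I (X (some d)))}).radical.comap
      (algebraMap (FixedPoints.subalgebra k U (Subgroup.zpowers σU)) U) = augIdeal τbar := by
  classical
  have h2k : (2 : k) ≠ 0 := by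
    intro h
    have h' : ((2 : ℕ) : k) = 0 := by exact_mod_cast h
    rw [CharP.cast_eq_zero_iff k p] at h'
    have := Nat.le_of_dvd (by norm_num) h'
    omega
  have hp2 : p ≠ 2 := by omega
  have hodd : Odd p := hp.odd_of_ne_two hp2
  have hσp : σU ^ p = 1 :=
    cover_pow_prime_eq_one_U k n a b c d e hab hac had hae hbc hbd hbe hcd hce hde I ι U σU hs h1 h2 h3
      h4 hσ hp hp5
  haveI : Finite (Subgroup.zpowers σU) :=
    Set.finite_coe_iff.mpr (isOfFinOrder_iff_pow_eq_one.mpr ⟨p, hp.pos, hσp⟩).finite_zpowers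
  haveI : Algebra.FiniteType k U := away_quotient_finiteType k n I ι U
  have hcomm : ∀ u, σU (τU u) = τU (σU u) :=
    cover_comm_coverTau_apply k n a b c d e hab hac had hae hbc hbe hcd hde I ι U σU hs h1 h2 h3 h4 hσ τU
      τs τb τd τi
  have hττ : ∀ u, τU (τU u) = u := coverTau_involutive k n b d I ι U τU τs τb τd τi
  have htbtb : ∀ v, τbar (τbar v) = v := InvolutionExit.restrict_involutive σU τU τbar hτbar hττ
  have htbtb' : ∀ v, τbar.toRingEquiv (τbar.toRingEquiv v) = v := htbtb
  have haug : augIdeal τbar.toRingEquiv = augIdeal τbar := rfl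
  -- `2` is a unit of `V`
  have h2V : IsUnit (2 : FixedPoints.subalgebra k U (Subgroup.zpowers σU)) := by
    have h := (isUnit_iff_ne_zero.mpr h2k).map
      (algebraMap k (FixedPoints.subalgebra k U (Subgroup.zpowers σU)))
    rwa [map_ofNat] at h
  have hrad : (augIdeal τbar).IsRadical := by
    rw [← haug]; exact InvolutionExit.isRadical_augIdeal τbar.toRingEquiv htbtb' h2V
  refine InvolutionExit.comap_radical_eq_augIdeal σU τU τbar hτbar hrad _ (fun u => ?_) ?_
  · exact Ideal.le_radical
      (augIdeal_coverTau_le_oddIdeal k n b d I ι U τU τs τb τd τi hτι (sub_mem_augIdeal τU u))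
  · -- `(s, Y₁, Y₃) ⊆ √(I_{τ̄}·U)`
    have hsV : algebraMap _ U (Ideal.Quotient.mk I (X none)) ∈
        FixedPoints.subalgebra k U (Subgroup.zpowers σU) :=
      (mem_fixedPoints_zpowers_iff_apply_eq σU _).mpr hs
    have hanti : ∀ (y : U) (hyV : y ∈ FixedPoints.subalgebra k U (Subgroup.zpowers σU)),
        τU y = -y → y ∈ (augIdeal τbar).map
          (algebraMap (FixedPoints.subalgebra k U (Subgroup.zpowers σU)) U) := by
      intro y hyV hy
      have hyA : (⟨y, hyV⟩ : FixedPoints.subalgebra k U (Subgroup.zpowers σU)) ∈ augIdeal τbar := by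
        rw [← haug]
        refine InvolutionExit.mem_augIdeal_of_anti τbar.toRingEquiv htbtb' h2V (Subtype.ext ?_)
        change ((τbar ⟨y, hyV⟩ : FixedPoints.subalgebra k U (Subgroup.zpowers σU)) : U) = -y
        rw [hτbar, hy]
      exact Ideal.mem_map_of_mem _ hyA
    have hsmap := hanti _ hsV τs
    have hspan : Ideal.span {algebraMap _ U (Ideal.Quotient.mk I (X none))} ≤ (augIdeal τbar).map
        (algebraMap (FixedPoints.subalgebra k U (Subgroup.zpowers σU)) U) :=
      (Ideal.span_singleton_le_iff_mem _).mpr hsmap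
    -- norms of anti-invariant elements
    have hN : ∀ {y : U}, τU y = -y → y ^ p ∈ (augIdeal τbar).map
        (algebraMap (FixedPoints.subalgebra k U (Subgroup.zpowers σU)) U) := by
      intro y hy
      have hNV : (∏ i ∈ Finset.range p, (σU ^ i) y) ∈
          FixedPoints.subalgebra k U (Subgroup.zpowers σU) :=
        InvolutionExit.orbitProd_mem_fixedPoints σU p hσp y
      have hNanti : τU (∏ i ∈ Finset.range p, (σU ^ i) y) = -∏ i ∈ Finset.range p, (σU ^ i) y := by
        rw [InvolutionExit.apply_orbitProd_of_anti σU p τU hcomm hy, hodd.neg_one_pow, neg_one_mul]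
      have hNmap := hanti _ hNV hNanti
      have hdiff : (∏ i ∈ Finset.range p, (σU ^ i) y) - y ^ p ∈ (augIdeal τbar).map
          (algebraMap (FixedPoints.subalgebra k U (Subgroup.zpowers σU)) U) :=
        hspan (augIdeal_cover_le_span_s k n a b c d e hab hac had hae I ι U σU hs h1 h2 h3 h4 hσ hσι
          (InvolutionExit.orbitProd_sub_pow_mem_augIdeal σU p y))
      have e : y ^ p = (∏ i ∈ Finset.range p, (σU ^ i) y) -
          ((∏ i ∈ Finset.range p, (σU ^ i) y) - y ^ p) := by ring
      rw [e]
      exact sub_mem hNmap hdiff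
    refine Ideal.span_le.2 ?_
    rintro x hx
    simp only [Set.mem_insert_iff, Set.mem_singleton_iff] at hx
    rcases hx with rfl | rfl | rfl
    · exact Ideal.le_radical hsmap
    · exact ⟨p, hN τb⟩
    · exact ⟨p, hN τd⟩

end Summit.ResolutionOfSingularities.ResolutionOfSingularities.Theorems.WildQuotientResolution.JordanFive

end
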